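import Summits.ABC.IUTFork.LDHGenuineHullRegimeSlack
import Summits.ABC.IUTFork.LDHGenuinePerImageExplicit
import HarnessLib

/-!
# The fork at [IUTchIII] Corollary 3.12, L-DH level, READING (P): the SHALLOW regime — the (P)-line crux HOLDS at every genuine
# datum with `((l+1)/24 − 1/(2l))·log q^{∤{2,l}}(λ) ≤ ((l+5)/4)·log π` (abc-iut cell, crux ThetaPartII = stmt-ABC-19678,
# registered stub `stub_cor312PerImage` (iii-P); non-vacuity / honest-scope record)

Record-only PROOF file (D-0012) of the abc-iut cell (WAVE-3 discharge seat abc-iut-c312-d1, gen 6); TAKES NO SIDE on [IUTchIII]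
Cor. 3.12 or on the (U)/(P) readings. The (P)-twin of abc-iut-skel's `GenuineContent.cor312Of_of_shallow` (`ForkGenuineRegimes.lean`,
reading (U)): the FREE inequality in reading (P) — the bare Θ-region `O_𝕃(−P_Θ)` lies in the hull of its own (Ind2)-orbit at the identity slot,
so `−deĝ̲_lgp(P_Θ) ≤ −|log(Θ)|^{nonarch}_(P)` — together with the archimedean summand `((l+5)/4)·log π` ([IUTchIV] Step (vii)) pays the gap
`((l+1)/24 − 1/(2l))·deĝ̲(𝔮)` whenever the latter is small:

* `DHData.free_inequality_perImage_input` — `−deĝ̲_lgp(P_Θ) ≤ negLogThetaPerImageNonarch I` for EVERY genuine Θ-volume input (the region is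
  admissible, the slot hull is admissible in the summed degrees — abc-iut-S7 `slotComponentBound_ofInput` —, the region lies in it, `log μ̄` is
  monotone; NO non-identity indeterminacy is used);
* `ThetaVolumeInput.cor312PerImageOf_of_shallow` — `((l+1)/24 − 1/(2l))·deĝ̲(𝔮) ≤ ((l+5)/4)·log π → I.Cor312PerImageOf`;
* **`Cor22.cor312PerImageAtDatum_of_shallow`** — at a `λ`-line point `P ∈ U` and a prime `l`:
  `((l+1)/24 − 1/(2l))·log q^{∤{2,l}}(λ) ≤ ((l+5)/4)·log π → Cor22.Cor312PerImageAtDatum P l` — the conclusion of the registered stub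
  `stub_cor312PerImage` is a THEOREM at such `(P, l)` (and so is the (U)-stub's, `Cor312AtDatum`, by `cor312AtDatum_of_perImage`).

READING (statement about OUR typed objects). Together with this seat's `szpiro_of_cor312PerImageAtDatum(_tame_six)` (p437310/p437841) the
(P)-line crux at an admissible `(P, l)` is SANDWICHED between two explicit inequalities on `log q^{∤{2,l}}(λ)`: TRUE whenever
`log q ≤ ((l+5)/4)·log π/κ_l` (`≈ 13.1` at `l = 7`; `κ_l = (l+1)/24 − 1/(2l)`), and, if true, forcing the Szpiro-type bound
`(1/6 − 2/(l(l+1)))·log q ≤ c·(log-diff + log-cond) + O(log l)` (tame data: `c → 6`). Between the two thresholds its truth value is the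
sign of one explicit affine function of the content integers of the datum (abc-iut-c312-3's exact volume) — the disputed content proper.
[cite: Mochizuki2012, IUTchIII Cor. 3.12 p. 173–174; proof Step (x) p. 181] [cite: Mochizuki2012, IUTchIV Thm. 1.10 Step (vii) p. 30]
[cite: DupuyHilado2025, §4.10–4.12] [claim: Mochizuki2012, status: disputed] for every IUT quotation. PROOF-ONLY: no definitions, no new `Prop`.
-/

noncomputable section

namespace Summit.ABC.IUTFork

open Literature.IUT.HodgeTheaters Literature.IUT.LogVolume NumberField IsDedekindDomain
open Literature.NumberTheory.DiophantineGeometry.GenEll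
open scoped Nat.Prime

namespace DHData

variable {F₀ : Type} [Field F₀] [NumberField F₀] {K : Type} [Field K] [NumberField K] [Algebra F₀ K]
variable (I : ThetaVolumeInput F₀ K)

/-- **The FREE inequality in reading (P)**: `−deĝ̲_lgp(P_Θ) ≤ negLogThetaPerImageNonarch I` for every genuine Θ-volume input — the
sharp region `O_𝕃(−P_Θ)` lies in the hull of its (Ind2)-orbit at the identity slot, summand by summand over the support primes and the
degrees `1 … ℓ⋇`; both are admissible there (abc-iut-S7 `slotComponentBound_ofInput`); `log μ̄` is monotone; Dupuy–Hilado Thm. 3.10.1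
gives `ln ν̄_𝕃(O_𝕃(−P_Θ)) = −deĝ̲_lgp(P_Θ)`. [cite: DupuyHilado2025, Thm. 3.10.1, §4.11–4.12] -/
theorem free_inequality_perImage_input : -LgpDivisor.ndegLgp I.X.thetaPilot ≤ I.negLogThetaPerImageNonarch := by
  classical
  rw [← lnνL_hullUThetaSlot_ofInput I]
  have hreg : (ofInput I).M.lnνL I.X.lstar I.supportPrimes ((ofInput I).M.region (ofInput I).tΘ) =
      -LgpDivisor.ndegLgp I.X.thetaPilot := (ofInput I).lnνL_regionΘ
  rw [← hreg]
  unfold PacketModel.lnνL PacketModel.lnνLp PacketModel.lnνTensorPower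
  refine Finset.sum_le_sum fun p hp => mul_le_mul_of_nonneg_left
    (Finset.sum_le_sum fun i _ => Finset.sum_le_sum fun e _ =>
      mul_le_mul_of_nonneg_right ?_ (Finset.prod_nonneg fun k _ => weight_nonneg F₀ (e k).1)) ?_
  · haveI hp' : Fact p.Prime := ⟨I.prime_of_mem_supportPrimes hp⟩
    have hadm := (slotComponentBound_ofInput I i e
      (Finset.univ.filter (fun a => p - 2 < absRamificationIdx p ((I.σ.localFieldFamily p hp'.out).k (e a))))
      (fun a ha => by
        rw [Finset.mem_filter, not_and] at ha
        exact Nat.le_of_not_lt (ha (Finset.mem_univ a)))).1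
    refine (ofInput I).M.logμ_mono ((ofInput I).M.region_adm (ofInput I).tΘ p _ e) hadm fun x hx => ?_
    exact (IndPacketModel.UThetaSlot_le_hullUThetaSlot (ofInput I).M (ofInput I).ind3) p _ e
      (IndPacketModel.bare3_subset_UThetaSlot (ofInput I).M (ofInput I).ind3 p _ e
        ((ofInput I).ind3.region_subset p _ e hx))
  · positivity

/-- Hence `−deĝ̲_lgp(P_Θ) + ((l+5)/4)·log π ≤ −|log(Θ)|_(P)` for every genuine input. [cite: Mochizuki2012, IUTchIV Thm. 1.10 Step (vii) p. 30] -/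
theorem neg_ndegLgp_add_arch_le_negLogThetaPerImage :
    -LgpDivisor.ndegLgp I.X.thetaPilot + ThetaVolumeInput.archLogTheta I.l ≤ I.negLogThetaPerImage := by
  have := free_inequality_perImage_input I
  unfold ThetaVolumeInput.negLogThetaPerImage
  linarith

end DHData

namespace GenuineContent

variable {F₀ : Type} [Field F₀] [NumberField F₀] {K : Type} [Field K] [NumberField K] [Algebra F₀ K]
variable (I : ThetaVolumeInput F₀ K)

/-- **THE SHALLOW REGIME, READING (P) — [IUTchIII] Cor. 3.12 (per image) HOLDS at every genuine input with small `q`-divisor degree**: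
if `((l+1)/24 − 1/(2l))·deĝ̲(𝔮) ≤ ((l+5)/4)·log π` then `Cor312PerImageOf I` (free inequality in reading (P) + the archimedean summand).
A kernel theorem about the tree's typed numbers; no side taken on the disputed inference (the claim for ALL initial Θ-data).
[cite: Mochizuki2012, IUTchIII Cor. 3.12 p. 173–174] [cite: Mochizuki2012, IUTchIV Thm. 1.10 Step (vii) p. 30] -/
theorem cor312PerImageOf_of_shallow
    (h : (((I.X.l : ℝ) + 1) / 24 - 1 / (2 * (I.X.l : ℝ))) * FinDivisor.ndeg F₀ I.X.qDivisor ≤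
      ThetaVolumeInput.archLogTheta I.l) :
    I.Cor312PerImageOf := by
  have hfree := DHData.free_inequality_perImage_input I
  rw [DHData.ndegLgp_thetaPilot_eq] at hfree
  have hq := I.negAbsLogQ_eq
  unfold ThetaVolumeInput.Cor312PerImageOf ThetaVolumeInput.negLogThetaPerImage
  rw [hq]
  have hsplit : (((I.X.l : ℝ) + 1) / 24 - 1 / (2 * (I.X.l : ℝ))) * FinDivisor.ndeg F₀ I.X.qDivisor =
      ((I.X.l : ℝ) + 1) / 24 * FinDivisor.ndeg F₀ I.X.qDivisor
        - 1 / (2 * (I.X.l : ℝ)) * FinDivisor.ndeg F₀ I.X.qDivisor := sub_mul _ _ _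
  change -(1 / (2 * (I.X.l : ℝ))) * FinDivisor.ndeg F₀ I.X.qDivisor ≤
    I.negLogThetaPerImageNonarch + ThetaVolumeInput.archLogTheta I.X.l
  change _ ≤ ThetaVolumeInput.archLogTheta I.X.l at h
  linarith

end GenuineContent

end Summit.ABC.IUTFork

/-! ## At the Θ-data of a point of the `λ`-line -/

namespace Literature.IUT.LogVolume.Cor22

open Literature.NumberTheory.DiophantineGeometry.GenEll Summit.ABC.IUTFork Literature.IUT.HodgeTheaters

variable {P : NFPoint} {l : ℕ}

/-- **THE (P)-LINE CRUX IS A THEOREM AT SHALLOW POINTS**: for a `λ`-line point `P ∈ U` and any `l`, if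
`((l+1)/24 − 1/(2l))·log q^{∤{2,l}}(λ) ≤ ((l+5)/4)·log π` then `Cor22.Cor312PerImageAtDatum P l` — every genuine datum at `(P, l)`
satisfies [IUTchIII] Cor. 3.12 in reading (P) (at `l = 7`: `log q^{∤{2,7}}(λ) ≤ 12·log π/(8·(1/3 − 1/14)) ≈ 13.1`). Non-vacuity / honest-scope
record for the registered stub `stub_cor312PerImage`; no side taken on its content at other points.
[cite: Mochizuki2012, IUTchIII Cor. 3.12 p. 173–174] [cite: Mochizuki2012, IUTchIV Thm. 1.10 Step (vii) p. 30; Cor. 2.2 (ii) proof p. 46] -/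
theorem cor312PerImageAtDatum_of_shallow (hU : P.InU)
    (h : (((l : ℝ) + 1) / 24 - 1 / (2 * l)) * Cor22.logQAvoid P {2, l} ≤ ThetaVolumeInput.archLogTheta l) :
    Cor22.Cor312PerImageAtDatum P l := by
  intro T
  letI := T.instFieldF; letI := T.instNumberFieldF; letI := T.instAlgebraF; letI := T.instFieldK
  letI := T.instNumberFieldK; letI := T.instAlgebraK; letI := T.instFieldFbar; letI := T.instAlgebraFbar
  letI := T.instAlgebraKFbar; letI := T.instIsElliptic
  have hgap := PointDict.gap_eq T hU
  -- `T.gap = κ_l·log q^{∤{2,l}}(λ)` and `T.gap = deĝ̲_lgp − deĝ̲(P_q) = κ_{X.l}·deĝ̲(𝔮)` for the datum's pilot data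
  have hXl : ((T.I.X.l : ℕ) : ℝ) = (l : ℝ) := by exact_mod_cast T.isVolumeInputOf.l_eq
  show T.I.Cor312PerImageOf
  refine GenuineContent.cor312PerImageOf_of_shallow T.I ?_
  rw [hXl]
  have hg : T.gap = (((l : ℝ) + 1) / 24 - 1 / (2 * l)) * FinDivisor.ndeg (fieldOfModuli T.E) T.I.X.qDivisor := by
    show LgpDivisor.ndegLgp T.I.X.thetaPilot - FinDivisor.ndeg _ T.I.X.qPilot = _
    rw [DHData.ndegLgp_thetaPilot_eq, PilotData.qPilot_eq_smul, map_smul, smul_eq_mul, hXl]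
    ring
  rw [← hg, hgap]
  have hXlN : T.I.X.l = l := T.isVolumeInputOf.l_eq
  change _ ≤ ThetaVolumeInput.archLogTheta T.I.X.l
  rw [hXlN]
  exact h

/-- … and therefore also in reading (U) (`cor312AtDatum_of_perImage`). [cite: Mochizuki2012, IUTchIII Cor. 3.12 p. 173–174] -/
theorem cor312AtDatum_of_shallow' (hU : P.InU)
    (h : (((l : ℝ) + 1) / 24 - 1 / (2 * l)) * Cor22.logQAvoid P {2, l} ≤ ThetaVolumeInput.archLogTheta l) :
    Cor22.Cor312AtDatum P l :=
  cor312AtDatum_of_perImage (cor312PerImageAtDatum_of_shallow hU h)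

end Literature.IUT.LogVolume.Cor22

end
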